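import Summits.BirchSwinnertonDyer.BirchSwinnertonDyer.Theorems.GenusKolyvaginAtTwoPowDvdShaCardAtTwoRTGenusRestrictionDvd
import Summits.BirchSwinnertonDyer.BirchSwinnertonDyer.Theorems.GenusKolyvaginAtTwoCasselsTateTotallyComplex
import HarnessLib

/-!
# Route `GenusKolyvaginAtTwo`, LINE 18 / LINE 19 by-product `g ∣ G` (critic #179 (5)), SECOND EDITION: the Cassels–Tate input
# over the Heegner field DISCHARGED — `#Ш(E/ℚ)[2^∞] ∣ #Ш(E_K/K)[2^∞]` modulo `kolyvagin` and the ONE remaining published input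
# `CasselsTatePairingRat` (route item stmt-BirchSwinnertonDyer-19420, `exists_casselsTate_pairing (K := ℚ)`)

Seat `bsd-line-gk2-p3` g16 (cell `bsd-f1-sign2`), `--supports stmt-BirchSwinnertonDyer-23242` (helper; closes nothing; CONDITIONAL,
D-0014).  THEOREMS ONLY; BSD is not proved by any of this.

`…PowDvdShaCardAtTwoRTGenusRestrictionDvd` (this seat, p670238) proved the genus restriction divisibility behind
`exists_casselsTate_pairing` over `ℚ` AND over `K`.  The LEAD gk2-p1 g12 has since made the Cassels–Tate theorem UNCONDITIONAL over
every totally complex number field (`GenusExact.CasselsTateTotallyComplex.exists_casselsTate_pairing_of_isTotallyComplex`, p671339 +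
composition, from Cassels' alternation `ctGeneralFun_self_eq_zero`), and an imaginary quadratic `K` is totally complex
(`IsImaginaryQuadratic K = (finrank ℚ K = 2 ∧ IsTotallyComplex K)`).  Hence:

* `natCard_primaryComponent_sha_dvd_baseChange_of_kolyvagin_of_casselsTateRat` — the habitat theorem with hypotheses
  `kolyvagin N_E W K` and `exists_casselsTate_pairing (K := ℚ)` only;
* `stub_genusRestrictionDvd_of_kolyvagin_of_casselsTateRat` / `stub_genusRestrictionDvdPos_of_kolyvagin_of_casselsTateRat` — the
  LINE 18 / LINE 19 (v1) stub signatures VERBATIM behind `∀ N W K, kolyvagin N W K` and `exists_casselsTate_pairing (K := ℚ)`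
  (= route item 19420 `CasselsTatePairingRat`, whose `2`-power levels are gk2-p2's real-place port in progress).

References: [Cassels1962ArithmeticIV]; [MilneADT2006] I Thm. 6.13; [Kramer1981] proof of Thm. 2; [Gross1991] Thm. 1.3.
-/

set_option autoImplicit false
-- the Theorems namespace of this sub repeats the summit name by design (D-0017 nested layout)
set_option linter.dupNamespace false

noncomputable section

open scoped Classical

namespace Summit.BirchSwinnertonDyer.BirchSwinnertonDyer.Theorems.GenusExact.PlusDescent

open WeierstrassCurve NumberField Literature.NumberTheory.EllipticCurves
  Literature.NumberTheory.EllipticCurves.ModularForms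
  Summit.BirchSwinnertonDyer.BirchSwinnertonDyer.Theorems.GenusExact.CasselsTateTotallyComplex

/-- **Genus restriction divisibility `#Ш(E/ℚ)[2^∞] ∣ #Ш(E_K/K)[2^∞]` modulo `kolyvagin` and the Cassels–Tate pairing over `ℚ`
ONLY** (the pairing over the imaginary quadratic `K` is the LEAD's unconditional
`exists_casselsTate_pairing_of_isTotallyComplex`, `K` being totally complex). [cite: Kramer1981, proof of Thm. 2]
[cite: Cassels1962ArithmeticIV] [cite: Gross1991, Thm. 1.3] -/
theorem natCard_primaryComponent_sha_dvd_baseChange_of_kolyvagin_of_casselsTateRat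
    (W : WeierstrassCurve ℚ) [W.IsElliptic] [W.IsGloballyMinimal] [NeZero (W.conductorNorm ℤ)]
    (K : Type) [Field K] [NumberField K]
    (hKo : kolyvagin (W.conductorNorm ℤ) W K) (hCTQ : exists_casselsTate_pairing (K := ℚ))
    (hK : IsImaginaryQuadratic K) (hodd : Odd (NumberField.discr K))
    (hH : SatisfiesHeegnerHypothesis (W.conductorNorm ℤ) K) (hρ : W.HasSurjectiveModNGaloisRep 2)
    {Dt : ModularParametrizationData W (W.conductorNorm ℤ)} {β : ℤ} {ι : K →+* ℂ}
    (d₁ : KolyvaginHeegnerData Dt β ι 1) (hy : ¬ IsOfFinAddOrder d₁.derivedPoint) :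
    Nat.card (AddCommGroup.primaryComponent W.sha 2) ∣
      Nat.card (AddCommGroup.primaryComponent (W.baseChange K).sha 2) :=
  haveI : IsTotallyComplex K := hK.2
  natCard_primaryComponent_sha_dvd_baseChange_of_kolyvagin_of_casselsTate W K hKo hCTQ
    exists_casselsTate_pairing_of_isTotallyComplex hK hodd hH hρ d₁ hy

/-- **LINE 18 `stub_genusRestrictionDvd` (v1 signature VERBATIM) modulo `kolyvagin` and `CasselsTatePairingRat` (item 19420)
only.** CONDITIONAL (D-0014). [cite: Kramer1981, proof of Thm. 2] [cite: Cassels1962ArithmeticIV] [cite: Gross1991, Thm. 1.3] -/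
theorem stub_genusRestrictionDvd_of_kolyvagin_of_casselsTateRat
    (hKo : ∀ (N : ℕ) [NeZero N] (W : WeierstrassCurve ℚ) (K : Type) [Field K] [NumberField K],
      kolyvagin N W K)
    (hCTQ : exists_casselsTate_pairing (K := ℚ)) :
    ∀ (W : WeierstrassCurve ℚ) [W.IsElliptic] [W.IsGloballyMinimal] [NeZero (W.conductorNorm ℤ)], ¬ W.HasCM →
      Odd W.tamagawaProduct → W.Δ < 0 → ∀ (K : Type) [Field K] [NumberField K],
      Literature.NumberTheory.EllipticCurves.IsImaginaryQuadratic K → Odd (NumberField.discr K) →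
      NumberField.discr K ≠ -3 →
      Literature.NumberTheory.EllipticCurves.SatisfiesHeegnerHypothesis (W.conductorNorm ℤ) K →
      ¬ IsSquare ((NumberField.discr K : ℚ) * -|W.Δ|) → ¬ IsSquare ((NumberField.discr K : ℚ) * (-(2 * |W.Δ|))) →
      (∀ n : ℕ, 0 < n → W.HasSurjectiveModNGaloisRep ((2 : ℤ) ^ n)) →
      ∀ (Dt : Literature.NumberTheory.EllipticCurves.ModularForms.ModularParametrizationData W (W.conductorNorm ℤ))
        (β : ℤ) (ι : K →+* ℂ) (d₁ : Literature.NumberTheory.EllipticCurves.KolyvaginHeegnerData Dt β ι 1),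
      ¬ IsOfFinAddOrder d₁.derivedPoint → ∀ (M₀ : ℕ),
      (∃ Q : (W.baseChange (Literature.NumberTheory.EllipticCurves.ringClassField K ι 1)).toAffine.Point,
        ((2 ^ M₀ : ℕ) : ℤ) • Q = d₁.derivedPoint) →
      (¬ ∃ Q : (W.baseChange (Literature.NumberTheory.EllipticCurves.ringClassField K ι 1)).toAffine.Point,
        ((2 ^ (M₀ + 1) : ℕ) : ℤ) • Q = d₁.derivedPoint) →
      ∀ (n : ℕ) (d : Literature.NumberTheory.EllipticCurves.KolyvaginHeegnerData Dt β ι n), Squarefree n →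
      (∀ ℓ ∈ n.primeFactors,
        Literature.NumberTheory.EllipticCurves.Zhang2014.IsKolyvaginPrime (W.conductorNorm ℤ) W K 2 ℓ) →
      (¬ ∃ Q : (W.baseChange (Literature.NumberTheory.EllipticCurves.ringClassField K ι n)).toAffine.Point,
        (2 : ℤ) • Q = d.derivedPoint) →
      Nat.card (AddCommGroup.primaryComponent W.sha 2) ∣
        Nat.card (AddCommGroup.primaryComponent (W.baseChange K).sha 2) := by
  intro W _ _ _ _hcm _hT _hΔ K _ _ hK hodd _h3 hH _hsq _hsq2 hsurj Dt β ι d₁ hy _M₀ _hdiv _hndiv _n _d _hn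
    _hKol _hprim
  exact natCard_primaryComponent_sha_dvd_baseChange_of_kolyvagin_of_casselsTateRat W K (hKo _ W K) hCTQ hK hodd hH
    (by simpa using hsurj 1 one_pos) d₁ hy

/-- **LINE 19 `stub_genusRestrictionDvdPos` (v1 signature VERBATIM, `0 < W.Δ` idle) modulo `kolyvagin` and
`CasselsTatePairingRat` (item 19420) only.** CONDITIONAL (D-0014). [cite: Kramer1981, proof of Thm. 2] [cite: Cassels1962ArithmeticIV]
[cite: Gross1991, Thm. 1.3] -/
theorem stub_genusRestrictionDvdPos_of_kolyvagin_of_casselsTateRat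
    (hKo : ∀ (N : ℕ) [NeZero N] (W : WeierstrassCurve ℚ) (K : Type) [Field K] [NumberField K],
      kolyvagin N W K)
    (hCTQ : exists_casselsTate_pairing (K := ℚ)) :
    ∀ (W : WeierstrassCurve ℚ) [W.IsElliptic] [W.IsGloballyMinimal] [NeZero (W.conductorNorm ℤ)], ¬ W.HasCM →
      Odd W.tamagawaProduct → 0 < W.Δ → ∀ (K : Type) [Field K] [NumberField K],
      Literature.NumberTheory.EllipticCurves.IsImaginaryQuadratic K → Odd (NumberField.discr K) →
      NumberField.discr K ≠ -3 →
      Literature.NumberTheory.EllipticCurves.SatisfiesHeegnerHypothesis (W.conductorNorm ℤ) K →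
      ¬ IsSquare ((NumberField.discr K : ℚ) * -|W.Δ|) → ¬ IsSquare ((NumberField.discr K : ℚ) * (-(2 * |W.Δ|))) →
      (∀ n : ℕ, 0 < n → W.HasSurjectiveModNGaloisRep ((2 : ℤ) ^ n)) →
      ∀ (Dt : Literature.NumberTheory.EllipticCurves.ModularForms.ModularParametrizationData W (W.conductorNorm ℤ))
        (β : ℤ) (ι : K →+* ℂ) (d₁ : Literature.NumberTheory.EllipticCurves.KolyvaginHeegnerData Dt β ι 1),
      ¬ IsOfFinAddOrder d₁.derivedPoint → ∀ (M₀ : ℕ),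
      (∃ Q : (W.baseChange (Literature.NumberTheory.EllipticCurves.ringClassField K ι 1)).toAffine.Point,
        ((2 ^ M₀ : ℕ) : ℤ) • Q = d₁.derivedPoint) →
      (¬ ∃ Q : (W.baseChange (Literature.NumberTheory.EllipticCurves.ringClassField K ι 1)).toAffine.Point,
        ((2 ^ (M₀ + 1) : ℕ) : ℤ) • Q = d₁.derivedPoint) →
      ∀ (n : ℕ) (d : Literature.NumberTheory.EllipticCurves.KolyvaginHeegnerData Dt β ι n), Squarefree n →
      (∀ ℓ ∈ n.primeFactors,
        Literature.NumberTheory.EllipticCurves.Zhang2014.IsKolyvaginPrime (W.conductorNorm ℤ) W K 2 ℓ) →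
      (¬ ∃ Q : (W.baseChange (Literature.NumberTheory.EllipticCurves.ringClassField K ι n)).toAffine.Point,
        (2 : ℤ) • Q = d.derivedPoint) →
      Nat.card (AddCommGroup.primaryComponent W.sha 2) ∣
        Nat.card (AddCommGroup.primaryComponent (W.baseChange K).sha 2) := by
  intro W _ _ _ _hcm _hT _hΔ K _ _ hK hodd _h3 hH _hsq _hsq2 hsurj Dt β ι d₁ hy _M₀ _hdiv _hndiv _n _d _hn
    _hKol _hprim
  exact natCard_primaryComponent_sha_dvd_baseChange_of_kolyvagin_of_casselsTateRat W K (hKo _ W K) hCTQ hK hodd hH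
    (by simpa using hsurj 1 one_pos) d₁ hy

end Summit.BirchSwinnertonDyer.BirchSwinnertonDyer.Theorems.GenusExact.PlusDescent

end
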